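import Summits.ResolutionOfSingularities.ResolutionOfSingularities.Theorems.FrobeniusClosingPatchingRelPerfectCuspDepthFourLineStepAlgebra
import HarnessLib

/-!
# Crux `PatchingRelPerfect` (stmt-ResolutionOfSingularities-16161), chain w52 — kernel certificate of
# the NON-GRADED DEPTH-FOUR member `(x₃² + x₀³) + 𝔪⁶`, part 1b: the LINE STEP (ring level)

[OURS · L1 W5.2 · kernel (iii) beyond F6, CHAIN v2.0 §1 (C)] With the chart algebra of part 1a
(`…CuspDepthFourLineStepAlgebra.lean`): for an arbitrary regular ring `R` with `(t, c, a)` weakly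
regular and `R/(t, c, a)` regular, blowing up `(t, a, c)` in the `y`-chart product
`F = P · Σ · K · ∏_{m=2}^{7} B_m` of the member `(x₃² + x₀³) + 𝔪⁶` (note
`NONGRADED-DEPTH4-MEMBER.md`, evidence #59; chart table kit j276688),

* on the `c`-chart every factor becomes a principal monomial (`map_F_one`);
* on the `t`-chart the residual is `Jt · (t, c₁)`, principalised by ONE more blowing up, of the
  regular surface `V(t, c₁) = Π₂ ∩ (t-chart)` (`map_F_zero` + part 1a's `isRegular_of_isBlowup_Jt`,
  the centre `(t/1, c/t)` being quasi-regular with regular quotient by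
  `isQuasiRegular_cons_chartGen` / `isRegularRing_quot_cons_chartGen`);
* on the `a`-chart the residual is the SAME kind of product one step down, `F′(t′, c′, a)` with
  `P′ = (a, c′)`, `Σ′ = (c′, a t′)`, `K′ = (c′² + t′ a²) + (a² t′⁴)`,
  `B′_k = (a^k (c′² + t′ a²)) + (c′^{k+2}) + (a^{k+2} t′^{2k+4})` (`map_F_two`),

so that `depthFour_of_aChart` reduces "every blowing up of `Spec R` along `F · (t, c, a)` is
regular" to the same statement for `F′` on the `a`-chart ring — part 2 = the surface step `Π₂`
there and `CoreRungTower.tangent_euclid_two 3` (p527008).  FORMAT evidence for the core on the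
`𝔪`-primary stratum; nothing here is a statement of the manuscript under review.

## References

* The Stacks Project, Tags 0804, 080A, 080B, 0BIQ. [StacksProject]
* U. Görtz, T. Wedhorn, *Algebraic Geometry I*, 2nd ed. 2020, Prop. 13.96 (2). [GortzWedhorn2020]
* Q. Liu, *Algebraic Geometry and Arithmetic Curves*, OUP 2002, Thm. 8.1.19 (a). [Liu2002]
-/

-- `Summit.<Summit>.<Sub>.Theorems` with `Sub = Summit` (single-conjunct summit, D-0017)
set_option linter.dupNamespace false

noncomputable section

open CategoryTheory CategoryTheory.Limits AlgebraicGeometry Literature.AlgebraicGeometry.Resolution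
open scoped Pointwise nonZeroDivisors

namespace Summit.ResolutionOfSingularities.ResolutionOfSingularities.Theorems

universe u

namespace CuspDepthFour

/-! ## Notation: the factors on the `y`-chart and their `a`-chart residuals -/

/-- `Π₂`-avatar image `P = (a²) + (c) + (t²)`. -/
local notation3 "Pf[" t "," c "," a "]" => (Ideal.span {a ^ 2} ⊔ Ideal.span {c} ⊔ Ideal.span {t ^ 2})
/-- `Σ̃`-avatar image `Σ = (c) + (t a) + (t²)`. -/
local notation3 "Sf[" t "," c "," a "]" => (Ideal.span {c} ⊔ Ideal.span {t * a} ⊔ Ideal.span {t ^ 2})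
/-- The member `K = (c² + t a³) + (t⁴)`. -/
local notation3 "Kf[" t "," c "," a "]" => (Ideal.span {c ^ 2 + t * a ^ 3} ⊔ Ideal.span {t ^ 4})
/-- Tangent-Euclid avatar image `B_{k+2} = (a^{2k}(c² + t a³)) + (c^{k+2}) + (t^{2k+4})`. -/
local notation3 "Bf[" t "," c "," a "," k "]" =>
  (Ideal.span {a ^ (2 * k) * (c ^ 2 + t * a ^ 3)} ⊔ Ideal.span {c ^ (k + 2)} ⊔ Ideal.span {t ^ (2 * k + 4)})
/-- The full `y`-chart product (without the centre `(t, a, c)`). -/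
local notation3 "Ff[" t "," c "," a "]" =>
  (Pf[t,c,a] * Sf[t,c,a] * Kf[t,c,a] * ∏ k ∈ Finset.range 6, Bf[t,c,a,k])
/-- `a`-chart residual of `P`: the surface `Π₂ = (a, c′)`. -/
local notation3 "Pa[" t "," c "," a "]" => (Ideal.span {a} ⊔ Ideal.span {c})
/-- `a`-chart residual of `Σ`: `(c′, a t′)`. -/
local notation3 "Sa[" t "," c "," a "]" => (Ideal.span {c} ⊔ Ideal.span {a * t})
/-- `a`-chart residual of `K`: `(c′² + t′ a²) + (a² t′⁴)`. -/
local notation3 "Ka[" t "," c "," a "]" => (Ideal.span {c ^ 2 + t * a ^ 2} ⊔ Ideal.span {a ^ 2 * t ^ 4})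
/-- `a`-chart residual of `B_{k+2}`: `(a^k (c′² + t′ a²)) + (c′^{k+2}) + (a^{k+2} t′^{2k+4})`. -/
local notation3 "Ba[" t "," c "," a "," k "]" =>
  (Ideal.span {a ^ k * (c ^ 2 + t * a ^ 2)} ⊔ Ideal.span {c ^ (k + 2)} ⊔ Ideal.span {a ^ (k + 2) * t ^ (2 * k + 4)})
/-- The full `a`-chart residual. -/
local notation3 "Fa[" t "," c "," a "]" =>
  (Pa[t,c,a] * Sa[t,c,a] * Ka[t,c,a] * ∏ k ∈ Finset.range 6, Ba[t,c,a,k])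
/-- `t`-chart residual of `B_{k+2}`: `(t^k a₁^{2k} (c₁² + t² a₁³)) + (c₁^{k+2}) + (t^{k+2})`. -/
local notation3 "Bt[" T "," C "," A "," k "]" =>
  (Ideal.span {T ^ k * A ^ (2 * k) * (C ^ 2 + T ^ 2 * A ^ 3)} ⊔ Ideal.span {C ^ (k + 2)} ⊔
    Ideal.span {T ^ (k + 2)})
/-- The `t`-chart residual WITHOUT one copy of the centre `(c₁, t)` of the surface step:
`(c₁, t) · (c₁², t²) · ∏ Bt`. -/
local notation3 "Jt[" T "," C "," A "]" =>
  ((Ideal.span {C} ⊔ Ideal.span {T}) * (Ideal.span {C ^ 2} ⊔ Ideal.span {T ^ 2}) *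
    ∏ k ∈ Finset.range 6, Bt[T,C,A,k])

/-! ## Chart images on the three Rees charts of `Bl_{(t, c, a)} Spec R` -/

section Charts

variable {R : Type u} [CommRing R] (t c a : R)

local notation3 "xx" => (![t, c, a] : Fin 3 → R)

set_option maxHeartbeats 400000 in
-- instance-path defeq through `HomogeneousLocalization`'s standalone `Pow`/`Mul` (as in p508825)
/-- **`a`-chart image**: `F · B_a = (a · a · a² · a²⁷) · F′(t′, c′, a)`, `t′ = t/a`, `c′ = c/a`.
[cite: StacksProject, Tag 0804] -/
theorem map_F_two :
    (Ff[t,c,a]).map (chartBase xx 2) =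
      Ideal.span {chartBase xx 2 a * chartBase xx 2 a * chartBase xx 2 a ^ 2 * chartBase xx 2 a ^ 27} *
        Fa[chartGen xx 2 0, chartGen xx 2 1, chartBase xx 2 a] := by
  have cb_t : chartBase xx 2 t = chartBase xx 2 a * chartGen xx 2 0 :=
    reesChartBase_apply_eq_mul_chartGen xx 2 0
  have cb_c : chartBase xx 2 c = chartBase xx 2 a * chartGen xx 2 1 :=
    reesChartBase_apply_eq_mul_chartGen xx 2 1
  have hP : (Pf[t,c,a]).map (chartBase xx 2) =
      Ideal.span {chartBase xx 2 a} * Pa[chartGen xx 2 0, chartGen xx 2 1, chartBase xx 2 a] := by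
    rw [Ideal.map_sup, Ideal.map_sup, CuspMember.map_span_singleton, CuspMember.map_span_singleton,
      CuspMember.map_span_singleton, map_pow, map_pow, cb_t, cb_c]
    exact aChart_P _ _ _
  have hS : (Sf[t,c,a]).map (chartBase xx 2) =
      Ideal.span {chartBase xx 2 a} * Sa[chartGen xx 2 0, chartGen xx 2 1, chartBase xx 2 a] := by
    rw [Ideal.map_sup, Ideal.map_sup, CuspMember.map_span_singleton, CuspMember.map_span_singleton,
      CuspMember.map_span_singleton, map_mul, map_pow, cb_t, cb_c]
    exact aChart_S _ _ _
  have hK : (Kf[t,c,a]).map (chartBase xx 2) =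
      Ideal.span {chartBase xx 2 a ^ 2} * Ka[chartGen xx 2 0, chartGen xx 2 1, chartBase xx 2 a] := by
    rw [Ideal.map_sup, CuspMember.map_span_singleton, CuspMember.map_span_singleton, map_add, map_pow,
      map_mul, map_pow, map_pow, cb_t, cb_c]
    exact aChart_K _ _ _
  have hB : ∀ k : ℕ, (Bf[t,c,a,k]).map (chartBase xx 2) =
      Ideal.span {chartBase xx 2 a ^ (k + 2)} * Ba[chartGen xx 2 0, chartGen xx 2 1, chartBase xx 2 a, k] := by
    intro k
    rw [Ideal.map_sup, Ideal.map_sup, CuspMember.map_span_singleton, CuspMember.map_span_singleton,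
      CuspMember.map_span_singleton, map_mul, map_pow, map_add, map_pow, map_mul, map_pow, map_pow,
      map_pow, cb_t, cb_c]
    exact aChart_B _ _ _ k
  rw [Ideal.map_mul, Ideal.map_mul, Ideal.map_mul, CoreRungTower.map_prod_range, hP, hS, hK]
  simp_rw [hB]
  rw [Finset.prod_mul_distrib, Ideal.prod_span_singleton, Finset.prod_pow_eq_pow_sum, sum_range_six]
  exact collect_two _ _ _ _ _

set_option maxHeartbeats 400000 in
-- instance-path defeq through `HomogeneousLocalization`'s standalone `Pow`/`Mul` (as in p508825)
/-- **`c`-chart image**: `F · B_c` is the principal monomial `(c · c · c² · c²⁷)`.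
[cite: StacksProject, Tag 0804] -/
theorem map_F_one :
    (Ff[t,c,a]).map (chartBase xx 1) =
      Ideal.span {chartBase xx 1 c * chartBase xx 1 c * chartBase xx 1 c ^ 2 * chartBase xx 1 c ^ 27} := by
  have cb_t : chartBase xx 1 t = chartBase xx 1 c * chartGen xx 1 0 :=
    reesChartBase_apply_eq_mul_chartGen xx 1 0
  have cb_a : chartBase xx 1 a = chartBase xx 1 c * chartGen xx 1 2 :=
    reesChartBase_apply_eq_mul_chartGen xx 1 2
  have hP : (Pf[t,c,a]).map (chartBase xx 1) = Ideal.span {chartBase xx 1 c} := by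
    rw [Ideal.map_sup, Ideal.map_sup, CuspMember.map_span_singleton, CuspMember.map_span_singleton,
      CuspMember.map_span_singleton, map_pow, map_pow, cb_t, cb_a]
    exact cChart_P _ _ _
  have hS : (Sf[t,c,a]).map (chartBase xx 1) = Ideal.span {chartBase xx 1 c} := by
    rw [Ideal.map_sup, Ideal.map_sup, CuspMember.map_span_singleton, CuspMember.map_span_singleton,
      CuspMember.map_span_singleton, map_mul, map_pow, cb_t, cb_a]
    exact cChart_S _ _ _
  have hK : (Kf[t,c,a]).map (chartBase xx 1) = Ideal.span {chartBase xx 1 c ^ 2} := by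
    rw [Ideal.map_sup, CuspMember.map_span_singleton, CuspMember.map_span_singleton, map_add, map_pow,
      map_mul, map_pow, map_pow, cb_t, cb_a]
    exact cChart_K _ _ _
  have hB : ∀ k : ℕ, (Bf[t,c,a,k]).map (chartBase xx 1) = Ideal.span {chartBase xx 1 c ^ (k + 2)} := by
    intro k
    rw [Ideal.map_sup, Ideal.map_sup, CuspMember.map_span_singleton, CuspMember.map_span_singleton,
      CuspMember.map_span_singleton, map_mul, map_pow, map_add, map_pow, map_mul, map_pow, map_pow,
      map_pow, cb_t, cb_a]
    exact cChart_B _ _ _ k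
  rw [Ideal.map_mul, Ideal.map_mul, Ideal.map_mul, CoreRungTower.map_prod_range, hP, hS, hK]
  simp_rw [hB]
  rw [Ideal.prod_span_singleton, Finset.prod_pow_eq_pow_sum, sum_range_six,
    Ideal.span_singleton_mul_span_singleton, Ideal.span_singleton_mul_span_singleton,
    Ideal.span_singleton_mul_span_singleton]

set_option maxHeartbeats 400000 in
-- instance-path defeq through `HomogeneousLocalization`'s standalone `Pow`/`Mul` (as in p508825)
/-- **`t`-chart image**: `F · B_t = (t · t · t² · t²⁷) · (Jt · (t, c₁))`, the residual supported on
the surface `V(t, c₁) = Π₂ ∩ (t-chart)`. [cite: StacksProject, Tag 0804] -/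
theorem map_F_zero :
    (Ff[t,c,a]).map (chartBase xx 0) =
      Ideal.span {chartBase xx 0 t * chartBase xx 0 t * chartBase xx 0 t ^ 2 * chartBase xx 0 t ^ 27} *
        (Jt[chartBase xx 0 t, chartGen xx 0 1, chartGen xx 0 2] *
          Ideal.span (Set.range ![chartBase xx 0 t, chartGen xx 0 1])) := by
  have cb_c : chartBase xx 0 c = chartBase xx 0 t * chartGen xx 0 1 :=
    reesChartBase_apply_eq_mul_chartGen xx 0 1
  have cb_a : chartBase xx 0 a = chartBase xx 0 t * chartGen xx 0 2 :=
    reesChartBase_apply_eq_mul_chartGen xx 0 2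
  have hP : (Pf[t,c,a]).map (chartBase xx 0) =
      Ideal.span {chartBase xx 0 t} * (Ideal.span {chartGen xx 0 1} ⊔ Ideal.span {chartBase xx 0 t}) := by
    rw [Ideal.map_sup, Ideal.map_sup, CuspMember.map_span_singleton, CuspMember.map_span_singleton,
      CuspMember.map_span_singleton, map_pow, map_pow, cb_c, cb_a]
    exact tChart_P _ _ _
  have hS : (Sf[t,c,a]).map (chartBase xx 0) =
      Ideal.span {chartBase xx 0 t} * (Ideal.span {chartGen xx 0 1} ⊔ Ideal.span {chartBase xx 0 t}) := by
    rw [Ideal.map_sup, Ideal.map_sup, CuspMember.map_span_singleton, CuspMember.map_span_singleton,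
      CuspMember.map_span_singleton, map_mul, map_pow, cb_c, cb_a]
    exact tChart_S _ _ _
  have hK : (Kf[t,c,a]).map (chartBase xx 0) =
      Ideal.span {chartBase xx 0 t ^ 2} * (Ideal.span {chartGen xx 0 1 ^ 2} ⊔ Ideal.span {chartBase xx 0 t ^ 2}) := by
    rw [Ideal.map_sup, CuspMember.map_span_singleton, CuspMember.map_span_singleton, map_add, map_pow,
      map_mul, map_pow, map_pow, cb_c, cb_a]
    exact tChart_K _ _ _
  have hB : ∀ k : ℕ, (Bf[t,c,a,k]).map (chartBase xx 0) =
      Ideal.span {chartBase xx 0 t ^ (k + 2)} * Bt[chartBase xx 0 t, chartGen xx 0 1, chartGen xx 0 2, k] := by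
    intro k
    rw [Ideal.map_sup, Ideal.map_sup, CuspMember.map_span_singleton, CuspMember.map_span_singleton,
      CuspMember.map_span_singleton, map_mul, map_pow, map_add, map_pow, map_mul, map_pow, map_pow,
      map_pow, cb_c, cb_a]
    exact tChart_B _ _ _ k
  have hspan : Ideal.span {chartGen xx 0 1} ⊔ Ideal.span {chartBase xx 0 t} =
      Ideal.span (Set.range ![chartBase xx 0 t, chartGen xx 0 1]) := by
    rw [CuspMember.span_range_vec2, sup_comm]
  rw [Ideal.map_mul, Ideal.map_mul, Ideal.map_mul, CoreRungTower.map_prod_range, hP, hS, hK]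
  simp_rw [hB]
  rw [Finset.prod_mul_distrib, Ideal.prod_span_singleton, Finset.prod_pow_eq_pow_sum, sum_range_six,
    ← hspan]
  exact collect_zero _ _ _ _

set_option maxHeartbeats 400000 in
-- instance-path defeq through `HomogeneousLocalization`'s standalone `Pow`/`Mul` (as in p508825)
/-- **REDUCTION TO THE `a`-CHART (the line step `L₁`).** For `R` regular, `(t, c, a)` weakly
regular and `R/(t, c, a)` regular: if every blowing up of the `a`-chart `B_a` of
`Bl_{(t,c,a)} Spec R` along the residual product `F′(t/a, c/a, a/1)` is regular, then every blowing
up of `Spec R` along `F(t, c, a) · (t, c, a)` is regular — the `c`-chart is Cartier (`map_F_one`),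
the `t`-chart is resolved by the surface step `V(t, c₁)` (`map_F_zero`, `isRegular_of_isBlowup_Jt`
with `(t/1, c/t)` quasi-regular and regular quotient by `isQuasiRegular_cons_chartGen` /
`isRegularRing_quot_cons_chartGen`), the `a`-chart is the hypothesis after twisting off the
monomial (`map_F_two`). [cite: StacksProject, Tag 080A] [cite: StacksProject, Tag 080B] -/
theorem depthFour_of_aChart [IsRegularRing R] (hw : RingTheory.Sequence.IsWeaklyRegular R [t, c, a])
    (h3 : IsRegularRing (R ⧸ (Ideal.span {t} ⊔ Ideal.span {c} ⊔ Ideal.span {a})))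
    (ha : ∀ (Y : Scheme.{u}) (ρ : Y ⟶ Spec (.of (chartRing xx 2))),
      IsBlowup ρ (affineBlowup.idealSheaf (Fa[chartGen xx 2 0, chartGen xx 2 1, chartBase xx 2 a])) →
        Scheme.IsRegular Y)
    {Y : Scheme.{u}} {f : Y ⟶ Spec (.of R)}
    (hf : IsBlowup f (affineBlowup.idealSheaf (Ff[t,c,a] * Ideal.span (Set.range xx)))) :
    Scheme.IsRegular Y := by
  have hx : IsQuasiRegular xx := CuspMember.isQuasiRegular_vec3 hw
  haveI hRx : IsRegularRing (R ⧸ Ideal.span (Set.range xx)) := by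
    rw [CuspMember.span_range_vec3]; exact h3
  refine isRegular_of_isBlowup_mul_of_charts xx _ (fun i Y' ρ hρ => ?_) hf
  haveI hB : IsRegularRing (chartRing xx i) := isRegularRing_blowupChart _ i hx
  have hi : i = 0 ∨ i = 1 ∨ i = 2 := by
    fin_cases i
    · exact Or.inl rfl
    · exact Or.inr (Or.inl rfl)
    · exact Or.inr (Or.inr rfl)
  rcases hi with rfl | rfl | rfl
  · -- `t`-chart: the surface step
    have hti : chartBase xx 0 t ∈ (chartRing xx 0)⁰ :=
      reesChartBase_mem_nonZeroDivisors (xx 0) (Ideal.mem_span_range_self (f := xx) (x := 0))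
    let jJ : Fin 1 → {j : Fin 3 // j ≠ 0} := fun _ => ⟨1, by decide⟩
    have hjJ : Function.Injective jJ := fun i j _ => Subsingleton.elim i j
    have hyy : (Fin.cons (chartBase xx 0 (xx 0)) (fun k => chartGen xx 0 (jJ k).1) :
        Fin 2 → chartRing xx 0) = ![chartBase xx 0 t, chartGen xx 0 1] := by
      ext i
      fin_cases i <;> rfl
    have hy : IsQuasiRegular (![chartBase xx 0 t, chartGen xx 0 1] : Fin 2 → chartRing xx 0) := by
      have h := isQuasiRegular_cons_chartGen xx 0 jJ hx hjJ
      rwa [hyy] at h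
    have hRy : IsRegularRing (chartRing xx 0 ⧸ Ideal.span (Set.range
        (![chartBase xx 0 t, chartGen xx 0 1] : Fin 2 → chartRing xx 0))) := by
      have h := isRegularRing_quot_cons_chartGen xx 0 jJ hx
      rwa [hyy] at h
    rw [map_F_zero] at hρ
    exact CoreRungTower.isRegular_of_isBlowup_span_singleton_mul
      (mul_mem (mul_mem (mul_mem hti hti) (pow_mem hti 2)) (pow_mem hti 27)) _
      (fun Y'' ρ' hρ' => isRegular_of_isBlowup_Jt _ _ _ hy hRy hρ') hρ
  · -- `c`-chart: Cartier
    have hc : chartBase xx 1 c ∈ (chartRing xx 1)⁰ :=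
      reesChartBase_mem_nonZeroDivisors (xx 1) (Ideal.mem_span_range_self (f := xx) (x := 1))
    rw [map_F_one] at hρ
    have hρ2 : IsBlowup ρ (affineBlowup.idealSheaf
        (Ideal.span {chartBase xx 1 c * chartBase xx 1 c * chartBase xx 1 c ^ 2 * chartBase xx 1 c ^ 27} *
          ⊤)) := by
      rwa [Ideal.mul_top]
    refine CoreRungTower.isRegular_of_isBlowup_span_singleton_mul
      (mul_mem (mul_mem (mul_mem hc hc) (pow_mem hc 2)) (pow_mem hc 27)) _ (fun Y'' ρ' hρ' => ?_) hρ2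
    rw [affineBlowup.idealSheaf_top] at hρ'
    haveI : IsIso ρ' := hρ'.isIso isEffectiveCartier_top
    haveI : IsRegularRing (CommRingCat.of (chartRing xx 1)) := hB
    exact SectionAscent.TraceIdeal.isRegular_of_iso (asIso ρ') (Scheme.isRegular_Spec _)
  · -- `a`-chart: twist off the monomial and descend
    have haz : chartBase xx 2 a ∈ (chartRing xx 2)⁰ :=
      reesChartBase_mem_nonZeroDivisors (xx 2) (Ideal.mem_span_range_self (f := xx) (x := 2))
    rw [map_F_two] at hρ
    exact CoreRungTower.isRegular_of_isBlowup_span_singleton_mul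
      (mul_mem (mul_mem (mul_mem haz haz) (pow_mem haz 2)) (pow_mem haz 27)) _ ha hρ

end Charts

end CuspDepthFour

end Summit.ResolutionOfSingularities.ResolutionOfSingularities.Theorems

end
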